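import Literature.MathematicalPhysics.QuantumFieldTheory.Balaban1983to89.B9CubeSequence408
import Literature.MathematicalPhysics.QuantumFieldTheory.Balaban1983to89.B6Partition118KLevelTorus

/-!
# `Balaban1983to89.B9CubeCutoffNearH` — THE SUPPORT OF THE CUT-OFF `h_□` OF (3.87) LIES NEAR □: `h^T_□(z) ≠ 0 ⟹ NearH □ z` — the hypothesis
# `hh : ∀ z, h z ≠ 0 → NearH q z` of `B9CubeLettersOpsL0.cutoff_deltaPrimeACubeY_eq` (the row agreement `h_□·Δ′_{a,□}(U) = h_□·Δ′_a(U)` of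
# (3.88)) DISCHARGED for the cell's cut-off of record `B6Partition118KLevelTorus.hT D □` (p38's `hTY i □`)
# (sub-row G-B9-LETTERS, modules M5.1c ∕ M5.4, file 1d)

FRAMING (verbatim cell line):
statement-level skeleton of published theorems with citation tags; proofs where landed; nothing here is a claim about the Yang–Mills mass gap

Sources under audit (cell lit-balaban): T. Bałaban, *Propagators for lattice gauge theories in a background field*, Commun. Math. Phys. **99**
(1985) 389–434 [`Balaban1985BackgroundPropagators`, "B9"], (3.87)–(3.88) p. 409, p. 408; T. Bałaban, *Propagators and renormalization
transformations for lattice gauge theories. II*, Commun. Math. Phys. **96** (1984) 223–250 [`Balaban1984PropagatorsII`, "[4]"], (2.36) p. 229;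
*… I*, Commun. Math. Phys. **95** (1984) 17–40 [`Balaban1984PropagatorsI`], (1.118) p. 36.  Unit `lit-balaban-r05` (r05 gen 77).

## WHAT IS PRINTED (verbatim up to notation)

[B9] p. 408–409: «We take the partition of unity {h_□} defined at the end of Sect. A in [4]. We have Σ h²_□ = 1 … G′₀ = Σ_□ h_□G′_□h_□ (3.87) …
Δ′_aG′₀ = I − Σ_□ K(h_□)G′_□h_□» — which uses that the rows of `Δ′_a` and of the cube operator `Δ′_{a,□}` coincide on `supp h_□`.  [4] (2.36) p. 229:
«the corresponding family of functions h described in (1.118) … rescale them to proper scales»; [4-I] (1.118): the bump `h` has `supp h ⊂ [−⅝, ⅝]`.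

## WHAT THIS FILE CERTIFIES (kernel-checked; member `D : B6MultiLevelTorusOperator.TDomains`, cover cube `q = (j, β)`, `S_j = M_h·L^{j+1}`)

* `circR_add_le'` — the real torus distance to `Nℤ` is 1-Lipschitz under translation (`circR N (t + u) ≤ circR N t + |u|`);
* `circAbs_le_of_thetaT_ne_zero` — where the periodic bump `θ^T_□` of the big block `β` is non-zero, every coordinate of `z` is within `S_j` (integer
  torus distance) of the lattice centre `ctrC q` of `β`: `θ^T_□(z) ≠ 0 ⟹ circAbs N₀ (z_μ − ctrC q μ) ≤ S_j` (the bump's profile `hprof` vanishes off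
  `(−⅝, ⅝)`, its argument is `dist(z_μ − (β_μ + ½)S_j, N₀ℤ)/(8S_j/5)`; `ctrC = (β + ½)S_j − ½`);
* ★ `nearH_of_hT_ne_zero` — `h^T_□(z) ≠ 0 ⟹ NearH q z` (`S_j + m_L·S_j ≤ widH = 3·hf_{j+1} + 1`), for odd `L`, odd `M_h ≥ 1`, `P ≥ 1`;
  hence (`nearH_of_hT`) the hypothesis of `cutoff_deltaPrimeACubeY_eq` holds for `h := h^T_□`.

## HONEST SCOPE

* Bookkeeping of supports; no inequality of the papers.  `NearH` is file 1's set (the `3^{d+1}` big `(j+1)`-blocks around the parent block of `β`).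
* Nothing is inferred from the manuscript; kernel-checked.  NOT summit progress; the YM mass gap is not proved by any of this.
-/

namespace Literature.MathematicalPhysics.QuantumFieldTheory.Balaban1983to89.B9CubeCutoffNearH

open Literature.MathematicalPhysics.QuantumFieldTheory.Balaban1983to89.B4Reflection242 (boxDom)
open Literature.MathematicalPhysics.QuantumFieldTheory.Balaban1983to89.B4TorusKernel.MultiPeriod (circAbs circAbs_le_abs circAbs_add_mul circAbs_nonneg)
open Literature.MathematicalPhysics.QuantumFieldTheory.Balaban1983to89.B4Sect5Torus (circAbs_add_le)
open Literature.MathematicalPhysics.QuantumFieldTheory.Balaban1983to89.B4PartitionUnity22 (hprof hprof_eq_zero)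
open Literature.MathematicalPhysics.QuantumFieldTheory.Balaban1983to89.B6MultiLevelBoxOperator (N0 bigSide)
open Literature.MathematicalPhysics.QuantumFieldTheory.Balaban1983to89.B6MultiLevelTorusOperator (one_le_N0)
open Literature.MathematicalPhysics.QuantumFieldTheory.Balaban1983to89.B6Cover236MultiLevelBlocks (cubes)
open Literature.MathematicalPhysics.QuantumFieldTheory.Balaban1983to89.B6Partition118KLevelTorus (circR thetaT hT thetaT_ne_zero_of_hT_ne_zero)
open Literature.MathematicalPhysics.QuantumFieldTheory.Balaban1983to89.B9CubeSequence408 (sI hf mL widH ctrC ctrH NearH sI_pos two_mul_hf_add_one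
  two_mul_mL mL_nonneg abs_ctrC_sub_ctrH_le)

variable {d ℓ Mh k R : ℕ} {P : Fin (d + 1) → ℕ} {D : B6MultiLevelTorusOperator.TDomains d ℓ Mh k P R}

/-- the real torus distance to `Nℤ` is 1-Lipschitz under translation. [cite: Balaban1984PropagatorsII, (2.36) p.229, bookkeeping] -/
theorem circR_add_le' (N : ℕ) (t u : ℝ) : circR N (t + u) ≤ circR N t + |u| := by
  unfold circR
  have key : |t + u - N * round ((t + u) / N)| ≤ |t + u - N * round (t / N)| := by
    -- `round` minimises the distance to `Nℤ`: compare with the integer `round (t/N)`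
    rcases Nat.eq_zero_or_pos N with hN | hN
    · subst hN; simp
    · have hNr : (0 : ℝ) < N := by exact_mod_cast hN
      have h := round_le ((t + u) / N) (round (t / N))
      have e1 : |t + u - N * round ((t + u) / N)| = N * |(t + u) / N - round ((t + u) / N)| := by
        rw [← abs_of_pos hNr, ← abs_mul, abs_of_pos hNr]; congr 1; field_simp
      have e2 : |t + u - N * round (t / N)| = N * |(t + u) / N - round (t / N)| := by
        rw [← abs_of_pos hNr, ← abs_mul, abs_of_pos hNr]; congr 1; field_simp
      rw [e1, e2]
      exact mul_le_mul_of_nonneg_left h hNr.le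
  calc |t + u - N * round ((t + u) / N)| ≤ |t + u - N * round (t / N)| := key
    _ = |(t - N * round (t / N)) + u| := by ring_nf
    _ ≤ |t - N * round (t / N)| + |u| := abs_add_le _ _

/-- **WHERE THE BUMP `θ^T_□` OF THE BIG BLOCK `β` IS NON-ZERO, EVERY COORDINATE IS WITHIN `S_j` OF THE LATTICE CENTRE OF `β`** (integer torus distance).
[cite: Balaban1984PropagatorsII, (2.36) p.229; Balaban1984PropagatorsI, (1.118) p.36 (supp h ⊂ [−⅝, ⅝])] -/
theorem circAbs_le_of_thetaT_ne_zero (hL : Odd (ℓ + 1)) (hM : Odd Mh) (hMh : 1 ≤ Mh) (hP : ∀ μ, 1 ≤ P μ) (q : ↥(cubes D.toDomains))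
    {z : ↥(boxDom (N0 ℓ Mh k P))} (hθ : thetaT ℓ Mh (N0 ℓ Mh k P) q.1 z.1 ≠ 0) (μ : Fin (d + 1)) :
    circAbs (N0 ℓ Mh k P μ) (z.1 μ - ctrC q μ) ≤ sI ℓ Mh q.1.1 := by
  -- the `μ`-th factor of the product is non-zero, so its argument is `< ⅝` in absolute value
  have hfac := (Finset.prod_ne_zero_iff.1 (by simpa only [thetaT] using hθ)) μ (Finset.mem_univ μ)
  set Nn : ℕ := N0 ℓ Mh k P μ with hNn
  set S : ℝ := (bigSide ℓ Mh q.1.1 : ℝ) with hSdef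
  set t : ℝ := (z.1 μ : ℝ) - ((q.1.2 μ : ℝ) + 1 / 2) * S with htdef
  have hS1 : (1 : ℝ) ≤ S := by
    rw [hSdef]; exact_mod_cast B6MultiLevelBoxOperator.one_le_bigSide (ℓ := ℓ) hMh q.1.1
  have hS0 : 0 < S := by linarith
  have harg : |circR Nn t / (8 / 5 * S)| < 5 / 8 := by
    by_contra hge
    exact hfac (hprof_eq_zero (not_lt.1 hge))
  have hcR : circR Nn t < S := by
    rw [abs_div, abs_of_nonneg (B6Partition118KLevelTorus.circR_nonneg _ _), abs_of_pos (by positivity),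
      div_lt_iff₀ (by positivity)] at harg
    linarith
  -- integer reduction: `ctrC = (β + ½)S − ½`, so `z − ctrC = t + ½`
  set m : ℤ := round (t / Nn) with hmdef
  have hcReq : circR Nn t = |t - Nn * m| := rfl
  have hS' : (sI ℓ Mh q.1.1 : ℝ) = S := by rw [hSdef]; unfold sI; push_cast; rfl
  have hctr : (ctrC q μ : ℝ) = ((q.1.2 μ : ℝ) + 1 / 2) * S - 1 / 2 := by
    have h1 := two_mul_hf_add_one hL hM q.1.1
    have h1' : (2 : ℝ) * (hf ℓ Mh q.1.1 : ℝ) + 1 = (sI ℓ Mh q.1.1 : ℝ) := by exact_mod_cast h1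
    unfold ctrC; push_cast
    rw [hS'] at h1'
    have : ((sI ℓ Mh q.1.1 : ℤ) : ℝ) = S := hS'
    rw [this]
    linarith
  set a : ℤ := z.1 μ - ctrC q μ - (Nn : ℤ) * m with hadef
  have hreal : (a : ℝ) = t + 1 / 2 - (Nn : ℝ) * m := by
    rw [hadef]; push_cast; rw [hctr, htdef]; ring
  have habs : |t + 1 / 2 - (Nn : ℝ) * m| < S + 1 / 2 :=
    calc |t + 1 / 2 - (Nn : ℝ) * m| = |(t - Nn * m) + 1 / 2| := by ring_nf
      _ ≤ |t - Nn * m| + |(1 / 2 : ℝ)| := abs_add_le _ _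
      _ < S + 1 / 2 := by rw [← hcReq, abs_of_pos (by norm_num : (0 : ℝ) < 1 / 2)]; linarith
  have hint : |a| ≤ sI ℓ Mh q.1.1 := by
    have h1 : ((|a| : ℤ) : ℝ) < (sI ℓ Mh q.1.1 : ℝ) + 1 := by
      rw [Int.cast_abs, hreal, hS']; linarith
    have h2 : |a| < sI ℓ Mh q.1.1 + 1 := by exact_mod_cast h1
    omega
  have hN : 1 ≤ Nn := one_le_N0 hMh hP μ
  calc circAbs Nn (z.1 μ - ctrC q μ)
      = circAbs Nn (a + Nn * m) := by rw [hadef]; ring_nf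
    _ = circAbs Nn a := circAbs_add_mul _ _ _
    _ ≤ |a| := circAbs_le_abs hN _
    _ ≤ sI ℓ Mh q.1.1 := hint

/-- ★ **THE SUPPORT OF `h^T_□` LIES NEAR □**: `h^T_□(z) ≠ 0 ⟹ NearH q z`. [cite: Balaban1985BackgroundPropagators, (3.87)–(3.88) p.409, p.408 (□³); Balaban1984PropagatorsII, (2.36) p.229] -/
theorem nearH_of_hT_ne_zero (hL : Odd (ℓ + 1)) (hM : Odd Mh) (hMh : 1 ≤ Mh) (hP : ∀ μ, 1 ≤ P μ) (q : ↥(cubes D.toDomains))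
    {z : ↥(boxDom (N0 ℓ Mh k P))} (h : hT D q z ≠ 0) : NearH q z.1 := by
  intro μ
  have hN : 1 ≤ N0 ℓ Mh k P μ := one_le_N0 hMh hP μ
  have h1 := circAbs_le_of_thetaT_ne_zero hL hM hMh hP q (thetaT_ne_zero_of_hT_ne_zero D h) μ
  have h2 : circAbs (N0 ℓ Mh k P μ) (ctrC q μ - ctrH q μ) ≤ mL ℓ * sI ℓ Mh q.1.1 :=
    (circAbs_le_abs hN _).trans (abs_ctrC_sub_ctrH_le hL hM hMh q μ)
  have h3 := circAbs_add_le hN (z.1 μ - ctrC q μ) (ctrC q μ - ctrH q μ)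
  rw [show z.1 μ - ctrC q μ + (ctrC q μ - ctrH q μ) = z.1 μ - ctrH q μ by ring] at h3
  have hS := sI_pos (ℓ := ℓ) hMh q.1.1
  have e1 := two_mul_hf_add_one hL hM q.1.1
  have e2 := two_mul_mL (ℓ := ℓ) hL
  have hm := mL_nonneg (ℓ := ℓ)
  have hhf : 0 ≤ hf ℓ Mh q.1.1 := by linarith
  unfold widH
  nlinarith

/-- the hypothesis `hh` of `B9CubeLettersOpsL0.cutoff_deltaPrimeACubeY_eq` for `h := h^T_□` (as a function on the torus box).
[cite: Balaban1985BackgroundPropagators, (3.87)–(3.88) p.409] -/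
theorem nearH_of_hT (hL : Odd (ℓ + 1)) (hM : Odd Mh) (hMh : 1 ≤ Mh) (hP : ∀ μ, 1 ≤ P μ) (q : ↥(cubes D.toDomains)) :
    ∀ z : ↥(boxDom (N0 ℓ Mh k P)), hT D q z ≠ 0 → NearH q z.1 :=
  fun _ h => nearH_of_hT_ne_zero hL hM hMh hP q h

end Literature.MathematicalPhysics.QuantumFieldTheory.Balaban1983to89.B9CubeCutoffNearH
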